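/-
COR-CM (cell pub-hodgecm2, stage 2 of the Hodge ladder) — count-neutral KERNEL COMBINATORICS «transport of the clock-model lattices to the intrinsic
currency» (seat prover-pub-hodgecm2-b23-g41-0, binder prover b23, gen 41; claim QUARTIC-TRANSPORT F2, HOME/INBOX.md l.10098).
Bookkeeping definitions with bodies (`tr`, `faces`) + theorems; Mathlib-only mathematics on top of part F1 (`Census/ClockTypesDictionary.lean`),
seat b09's clock model (`Census/QuarticTwistModel.lean`, `Census/QuarticTwistSquares.lean`) and the intrinsic currency (`CorCM/Prior/AllgGroup1.lean`,
`Census/BlockParityLaw.lean`, `Census/CoinvariantFibre.lean`), all used BY NAME; no `decide`, no certificate, no named fact, no `sorry`;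
`Interfaces.lean` (C1), every E term, B01, `Transposition/*`, `PortJoin/*` untouched.
HONEST FRAMING: `HC_CM` is NOT proved, here or anywhere in the tree; nothing here is a period, a count of record or a headline.
T5: n/a-class (no Prop-valued hypothesis binder beyond the datum equations and generation hypotheses on families); checker: self, 2026-08-23.
-/
import Summits.HodgeConjecture.CorCM.Census.ClockTypesDictionary
import Summits.HodgeConjecture.CorCM.Census.CoinvariantFibre

/-!
# Transport of the clock-model lattices: `hodge ↔ hodgeSpan`, `pairs ↔ pairSet`, `faceVec ↔ gface`, `transl ↔ rt`

Part F2 of the quartic-twist transport (F1 = `Census/ClockTypesDictionary.lean`: the bijection `typeEquiv : CMF G c ≃ Ty B` along a quartic datum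
`θ : G ≃ ZMod 4 × B`, `θ (PQ) = θ P + θ Q`, `θ c = (2,0)`).  Here the bijection is promoted to the `ℤ`-linear isomorphism of exponent lattices

  **`tr : (Ty B → ℤ) ≃ₗ[ℤ] (CMF G c →₀ ℤ)`**, `e_s ↦ [typeOf s]` (`tr_single`, `tr_apply`),

and everything seat b09's law speaks about is carried across BY NAME:
* §2 pairs: `tr (pairVec s) = pair (typeOf s)` and `tr (pairs B) = ℤ⟨pairSet⟩` (`map_pairs`);
* §3 faces: `tr (faceVec s p q) = gface (typeOf s) (plInv q) (plInv p)` (`tr_faceVec`; the corner order of `gface` lists the double flip second),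
  every abstract face is a transported clock face (`gface_eq_tr`), transported clock faces with `p ≠ q` are abstract faces (`tr_faceVec_mem_gfaceSet`);
* §4 Galois translation: `tr (transl g v) = (tr v)·(θ⁻¹(−g.1, g.2))⁻¹` (`tr_transl`, `mapDomain_rt_tr`), so `tr (spanFaces S) = ℤ⟨translates (faces S)⟩`
  (`map_spanFaces`) for the transported family `faces S`;
* §5 **the Hodge lattices agree**: `2·typeSum (tr v) (P) = ⟨coef (θP), v⟩ + Σ v` (`two_mul_typeSum_tr`), hence `tr (hodge B) = hodgeSpan`
  (`map_hodge`, via `Coinvariant.mem_hodgeSpan_of_forall_typeSum_eq` and `gfaces_generate`);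
* §6 **the two transfers**: generation in the model ⟹ generation by at most as many abstract faces (`generate_of_model`), and a generating family of
  abstract vectors ⟹ a generating model family of at most the same size, Hodge vectors going to Hodge vectors (`model_generate_of_translates`,
  `mem_hodge_of_mem_image`) — the form in which seat b09's floors `card_orb_le_card_add_two` / `card_orb_le_card_add_one_of_noScrew` are consumed in F3.

## References
* [Pohlmann1968] H. Pohlmann, Algebraic cycles on abelian varieties of complex multiplication type, Ann. of Math. 88 (1968), Thm 1.
-/

namespace Summit.HodgeConjecture.CorCM.Census.ClockTypes

open Finset
open Summit.HodgeConjecture.CorCM.Prior.AllgGroup.RfwfAllgGroup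
open Summit.HodgeConjecture.CorCM.Census.BlockParity
open Summit.HodgeConjecture.CorCM.Census.Coinvariant
open Summit.HodgeConjecture.CorCM.Census.QuarticTwist

noncomputable section

variable {G : Type*} [Group G] [Fintype G] [DecidableEq G] {c : G}
variable {B : Type} [AddGroup B] [Fintype B] [DecidableEq B]
variable (θ : G ≃ ZMod 4 × B)

/-! ## §1 The transport isomorphism -/

/-- **The transport** of exponent vectors of clock labels to integer combinations of abstract CM types: `e_s ↦ [typeOf s]`. [folklore] -/
def tr (hθ : ∀ P Q : G, θ (P * Q) = θ P + θ Q) (hθc : θ c = (2, 0)) : (Ty B → ℤ) ≃ₗ[ℤ] (CMF G c →₀ ℤ) :=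
  (Finsupp.linearEquivFunOnFinite ℤ ℤ (Ty B)).symm ≪≫ₗ Finsupp.domLCongr (typeEquiv θ hθ hθc).symm

omit [DecidableEq B] in
/-- Coefficients of a transported vector: `(tr v) Ψ = v (lab Ψ)`. [folklore] -/
theorem tr_apply (hθ : ∀ P Q : G, θ (P * Q) = θ P + θ Q) (hθc : θ c = (2, 0)) (v : Ty B → ℤ) (Ψ : CMF G c) :
    tr θ hθ hθc v Ψ = v (lab θ Ψ) := by
  simp [tr, Finsupp.domLCongr_apply, Finsupp.equivMapDomain_apply]

omit [DecidableEq B] in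
/-- **Unit vectors go to types**: `tr (c·e_s) = c·[typeOf s]`. [folklore] -/
@[simp] theorem tr_single (hθ : ∀ P Q : G, θ (P * Q) = θ P + θ Q) (hθc : θ c = (2, 0)) (s : Ty B) (n : ℤ) :
    tr θ hθ hθc (Pi.single s n) = Finsupp.single (typeOf θ hθ hθc s) n := by
  rw [tr, LinearEquiv.trans_apply, Finsupp.linearEquivFunOnFinite_symm_single, Finsupp.domLCongr_single,
    typeEquiv_symm_apply]

omit [DecidableEq B] in
/-- The inverse transport: `(tr⁻¹ y) s = y (typeOf s)`. [folklore] -/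
theorem tr_symm_apply (hθ : ∀ P Q : G, θ (P * Q) = θ P + θ Q) (hθc : θ c = (2, 0)) (y : CMF G c →₀ ℤ) (s : Ty B) :
    (tr θ hθ hθc).symm y s = y (typeOf θ hθ hθc s) := by
  have h : (tr θ hθ hθc).symm y = fun s => y (typeOf θ hθ hθc s) := by
    rw [LinearEquiv.symm_apply_eq]
    ext Ψ
    rw [tr_apply, typeOf_lab]
  rw [h]

/-- A vector is the sum of its transported unit vectors. [folklore] -/
theorem tr_eq_sum (hθ : ∀ P Q : G, θ (P * Q) = θ P + θ Q) (hθc : θ c = (2, 0)) (v : Ty B → ℤ) :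
    tr θ hθ hθc v = ∑ s, Finsupp.single (typeOf θ hθ hθc s) (v s) := by
  conv_lhs => rw [← Finset.univ_sum_single v]
  rw [map_sum]
  exact Finset.sum_congr rfl fun s _ => tr_single θ hθ hθc s (v s)

/-! ## §2 Pairs -/

omit [DecidableEq B] in
/-- **Pairs go to pairs**: `tr (e_s + e_{s+2}) = [typeOf s] + [typeOf s · c]`. [folklore] -/
theorem tr_pairVec (hθ : ∀ P Q : G, θ (P * Q) = θ P + θ Q) (hθc : θ c = (2, 0)) (s : Ty B) :
    tr θ hθ hθc (pairVec B s) = pair c (typeOf θ hθ hθc s) := by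
  rw [pairVec, map_add, tr_single, tr_single, pair, rt_self_typeOf θ hθ hθc]

omit [DecidableEq B] in
/-- **The divisor lattices agree**: `tr (pairs B) = ℤ⟨pairSet⟩`. [folklore] -/
theorem map_pairs (hθ : ∀ P Q : G, θ (P * Q) = θ P + θ Q) (hθc : θ c = (2, 0)) :
    (pairs B).map (tr θ hθ hθc : (Ty B → ℤ) →ₗ[ℤ] (CMF G c →₀ ℤ)) = Submodule.span ℤ (pairSet c) := by
  rw [pairs, Submodule.map_span, ← Set.range_comp]
  have h : ((tr θ hθ hθc : (Ty B → ℤ) →ₗ[ℤ] (CMF G c →₀ ℤ)) ∘ pairVec B) = pair c ∘ typeOf θ hθ hθc :=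
    funext fun s => by rw [Function.comp_apply, Function.comp_apply, LinearEquiv.coe_coe, tr_pairVec]
  have hsurj : Function.Surjective (typeOf θ hθ hθc) := (typeEquiv θ hθ hθc).symm.surjective
  rw [h, hsurj.range_comp]
  rfl

/-! ## §3 Faces -/

/-- **Clock faces go to abstract faces**: `tr (e_s − e_{s^{(p)}} − e_{s^{(q)}} + e_{s^{(p,q)}}) = gface (typeOf s) (plInv q) (plInv p)` (the corner
order of `gface Φ t t'` is `[Φ] + [Φ^{(t t')}] − [Φ^{(t)}] − [Φ^{(t')}]` with `Φ^{(t t')} = (Φ^{(t')})^{(t)}`). [folklore] -/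
theorem tr_faceVec (hθ : ∀ P Q : G, θ (P * Q) = θ P + θ Q) (hθc : θ c = (2, 0)) (hc2 : c * c = 1) (s : Ty B) (p q : ZMod 2 × B) :
    tr θ hθ hθc (faceVec B s p q) = gface c hc2 (typeOf θ hθ hθc s) (plInv θ q) (plInv θ p) := by
  rw [faceVec, gface]
  simp only [map_add, map_sub, tr_single, oflipCM_plInv_typeOf θ hθ hθc hc2]
  abel

/-- Abstract faces through types of labels are transported clock faces: `gface (typeOf s) t t' = tr (faceVec s (pl t') (pl t))`. [folklore] -/
theorem gface_typeOf (hθ : ∀ P Q : G, θ (P * Q) = θ P + θ Q) (hθc : θ c = (2, 0)) (hc2 : c * c = 1) (s : Ty B) (t t' : G) :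
    gface c hc2 (typeOf θ hθ hθc s) t t' = tr θ hθ hθc (faceVec B s (pl θ t') (pl θ t)) := by
  rw [faceVec, gface]
  simp only [map_add, map_sub, tr_single, oflipCM_typeOf θ hθ hθc hc2]
  abel

/-- **Every abstract face is a transported clock face**: `gface Φ t t' = tr (faceVec (lab Φ) (pl t') (pl t))`. [folklore] -/
theorem gface_eq_tr (hθ : ∀ P Q : G, θ (P * Q) = θ P + θ Q) (hθc : θ c = (2, 0)) (hc2 : c * c = 1) (Φ : CMF G c) (t t' : G) :
    gface c hc2 Φ t t' = tr θ hθ hθc (faceVec B (lab θ Φ) (pl θ t') (pl θ t)) := by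
  conv_lhs => rw [← typeOf_lab θ hθ hθc Φ]
  exact gface_typeOf θ hθ hθc hc2 (lab θ Φ) t t'

/-- **Transported clock faces at distinct places are abstract faces** (`∈ gfaceSet`). [folklore] -/
theorem tr_faceVec_mem_gfaceSet (hθ : ∀ P Q : G, θ (P * Q) = θ P + θ Q) (hθc : θ c = (2, 0)) (hc2 : c * c = 1) (s : Ty B)
    {p q : ZMod 2 × B} (hpq : p ≠ q) : tr θ hθ hθc (faceVec B s p q) ∈ gfaceSet G c hc2 :=
  ⟨typeOf θ hθ hθc s, plInv θ q, plInv θ p, plInv_not_mem_orb θ hθ hθc (Ne.symm hpq), tr_faceVec θ hθ hθc hc2 s p q⟩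

omit [Fintype G] in
/-- Clock faces at distinct places are Hodge vectors of the model (b09's `faceVec_mem`, restated with the place hypothesis in `∉ orb` form on `G`).
[folklore] -/
theorem faceVec_pl_mem_hodge (hθ : ∀ P Q : G, θ (P * Q) = θ P + θ Q) (hθc : θ c = (2, 0)) (s : Ty B) {t t' : G} (ht' : t' ∉ orb c t) :
    faceVec B s (pl θ t') (pl θ t) ∈ hodge B :=
  faceVec_mem B s ((not_mem_orb_iff_pl_ne θ hθ hθc t t').mp ht')

/-- **The transported face family** of a family of labelled clock faces `(s; p, q)`. [folklore] -/
def faces (hθ : ∀ P Q : G, θ (P * Q) = θ P + θ Q) (hθc : θ c = (2, 0)) (S : Finset (Ty B × (ZMod 2 × B) × (ZMod 2 × B))) :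
    Finset (CMF G c →₀ ℤ) :=
  S.image fun f => tr θ hθ hθc (faceVec B f.1 f.2.1 f.2.2)

/-- The transported family is no larger. [folklore] -/
theorem card_faces_le (hθ : ∀ P Q : G, θ (P * Q) = θ P + θ Q) (hθc : θ c = (2, 0)) (S : Finset (Ty B × (ZMod 2 × B) × (ZMod 2 × B))) :
    (faces θ hθ hθc S).card ≤ S.card :=
  Finset.card_image_le

/-- The transported family of a family of faces at distinct places consists of abstract faces. [folklore] -/
theorem faces_subset_gfaceSet (hθ : ∀ P Q : G, θ (P * Q) = θ P + θ Q) (hθc : θ c = (2, 0)) (hc2 : c * c = 1)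
    {S : Finset (Ty B × (ZMod 2 × B) × (ZMod 2 × B))} (hS : ∀ f ∈ S, f.2.1 ≠ f.2.2) :
    ↑(faces θ hθ hθc S) ⊆ gfaceSet G c hc2 := by
  intro y hy
  obtain ⟨f, hf, rfl⟩ := Finset.mem_image.mp (Finset.mem_coe.mp hy)
  exact tr_faceVec_mem_gfaceSet θ hθ hθc hc2 f.1 (hS f hf)

/-! ## §4 Galois translation -/

/-- **Translation is base change**: `tr (transl g v) = (tr v)·Q⁻¹` with `Q = θ⁻¹(−g.1, g.2)` (`Finsupp.mapDomain (rt Q)`). [folklore] -/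
theorem tr_transl (hθ : ∀ P Q : G, θ (P * Q) = θ P + θ Q) (hθc : θ c = (2, 0)) (g : ZMod 4 × B) (v : Ty B → ℤ) :
    tr θ hθ hθc (transl B g v) = Finsupp.mapDomain (rt c (θ.symm (-g.1, g.2))) (tr θ hθ hθc v) := by
  have hv : transl B g v = translHom B g (∑ s, Pi.single s (v s)) := by rw [translHom_apply, Finset.univ_sum_single]
  rw [hv, map_sum, map_sum, tr_eq_sum θ hθ hθc v, Finsupp.mapDomain_finsetSum]
  refine Finset.sum_congr rfl fun s _ => ?_
  rw [translHom_apply, transl_single, tr_single, typeOf_tw θ hθ hθc, Finsupp.mapDomain_single]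

/-- **Base change is translation**: `(tr v)·Q⁻¹ = tr (transl (−(θQ).1, (θQ).2) v)`. [folklore] -/
theorem mapDomain_rt_tr (hθ : ∀ P Q : G, θ (P * Q) = θ P + θ Q) (hθc : θ c = (2, 0)) (Q : G) (v : Ty B → ℤ) :
    Finsupp.mapDomain (rt c Q) (tr θ hθ hθc v) = tr θ hθ hθc (transl B (-(θ Q).1, (θ Q).2) v) := by
  rw [tr_transl θ hθ hθc]
  simp only [neg_neg, Prod.mk.eta, Equiv.symm_apply_apply]

/-- **The spans of translates agree**: `tr (spanFaces S) = ℤ⟨translates (faces S)⟩`. [folklore] -/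
theorem map_spanFaces (hθ : ∀ P Q : G, θ (P * Q) = θ P + θ Q) (hθc : θ c = (2, 0)) (S : Finset (Ty B × (ZMod 2 × B) × (ZMod 2 × B))) :
    (spanFaces B S).map (tr θ hθ hθc : (Ty B → ℤ) →ₗ[ℤ] (CMF G c →₀ ℤ)) = Submodule.span ℤ (translates c (faces θ hθ hθc S)) := by
  rw [spanFaces, Submodule.map_span]
  congr 1
  ext y
  constructor
  · rintro ⟨_, ⟨g, f, hf, rfl⟩, rfl⟩
    refine ⟨θ.symm (-g.1, g.2), tr θ hθ hθc (faceVec B f.1 f.2.1 f.2.2), Finset.mem_image.mpr ⟨f, hf, rfl⟩, ?_⟩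
    rw [LinearEquiv.coe_coe, tr_transl θ hθ hθc]
  · rintro ⟨Q, _, hs, rfl⟩
    obtain ⟨f, hf, rfl⟩ := Finset.mem_image.mp hs
    refine ⟨transl B (-(θ Q).1, (θ Q).2) (faceVec B f.1 f.2.1 f.2.2), ⟨(-(θ Q).1, (θ Q).2), f, hf, rfl⟩, ?_⟩
    rw [LinearEquiv.coe_coe, mapDomain_rt_tr θ hθ hθc]

/-! ## §5 The Hodge lattices agree -/

/-- Type sums of transported vectors: `typeSum (tr v) (P) = Σ_s v(s)·[P ∈ typeOf s]`. [folklore] -/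
theorem typeSum_tr_apply (hθ : ∀ P Q : G, θ (P * Q) = θ P + θ Q) (hθc : θ c = (2, 0)) (v : Ty B → ℤ) (P : G) :
    typeSum G c (tr θ hθ hθc v) P = ∑ s, v s * indG (typeOf θ hθ hθc s).1 P := by
  rw [tr_eq_sum θ hθ hθc, map_sum, Finset.sum_apply]
  refine Finset.sum_congr rfl fun s _ => ?_
  rw [← Finsupp.smul_single_one, map_smul, typeSum_single, Pi.smul_apply, smul_eq_mul]

/-- **Pohlmann forms are type sums**: `2·typeSum (tr v) (P) = ⟨coef (θ P), v⟩ + Σ_s v(s)` (`coef = 2·𝟙 − 1`, Pohlmann's coefficients). [folklore] -/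
theorem two_mul_typeSum_tr (hθ : ∀ P Q : G, θ (P * Q) = θ P + θ Q) (hθc : θ c = (2, 0)) (v : Ty B → ℤ) (P : G) :
    2 * typeSum G c (tr θ hθ hθc v) P = coef B (θ P) ⬝ᵥ v + ∑ s, v s := by
  rw [typeSum_tr_apply θ hθ hθc, dotProduct, Finset.mul_sum, ← Finset.sum_add_distrib]
  refine Finset.sum_congr rfl fun s _ => ?_
  simp only [indG, mem_typeOf, coef]
  split_ifs <;> ring

/-- **Model Hodge vectors go to Hodge vectors.** [folklore] -/
theorem tr_mem_hodgeSpan (hθ : ∀ P Q : G, θ (P * Q) = θ P + θ Q) (hθc : θ c = (2, 0)) (hc2 : c * c = 1) {v : Ty B → ℤ}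
    (hv : v ∈ hodge B) : tr θ hθ hθc v ∈ hodgeSpan c hc2 := by
  have hv' : ∀ g : ZMod 4 × B, coef B g ⬝ᵥ v = 0 := hv
  refine mem_hodgeSpan_of_forall_typeSum_eq c hc2 (c_ne_one θ hθ hθc) (mul_comm_of_datum θ hθ hθc)
    (k := typeSum G c (tr θ hθ hθc v) 1) fun P => ?_
  have h1 := two_mul_typeSum_tr θ hθ hθc v P
  have h2 := two_mul_typeSum_tr θ hθ hθc v 1
  rw [hv', zero_add] at h1 h2
  exact mul_left_cancel₀ two_ne_zero (h1.trans h2.symm)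

/-- **THE HODGE LATTICES AGREE**: `tr (hodge B) = hodgeSpan` — the clock model's Hodge lattice (common kernel of the Pohlmann forms) is the
intrinsic lattice of integer Hodge vectors `ℤ⟨faces⟩ + ℤ⟨pairs⟩` (Pohlmann). [folklore] -/
theorem map_hodge (hθ : ∀ P Q : G, θ (P * Q) = θ P + θ Q) (hθc : θ c = (2, 0)) (hc2 : c * c = 1) :
    (hodge B).map (tr θ hθ hθc : (Ty B → ℤ) →ₗ[ℤ] (CMF G c →₀ ℤ)) = hodgeSpan c hc2 := by
  refine le_antisymm ?_ ?_
  · rintro y ⟨v, hv, rfl⟩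
    exact tr_mem_hodgeSpan θ hθ hθc hc2 hv
  · refine sup_le (Submodule.span_le.mpr ?_) (Submodule.span_le.mpr ?_)
    · rintro _ ⟨Φ, t, t', ht', rfl⟩
      exact ⟨faceVec B (lab θ Φ) (pl θ t') (pl θ t), faceVec_pl_mem_hodge θ hθ hθc (lab θ Φ) ht',
        (gface_eq_tr θ hθ hθc hc2 Φ t t').symm⟩
    · rintro _ ⟨Ψ, rfl⟩
      refine ⟨pairVec B (lab θ Ψ), pairVec_mem B _, ?_⟩
      rw [LinearEquiv.coe_coe, tr_pairVec, typeOf_lab]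

/-- Membership form: `tr v ∈ hodgeSpan ↔ v ∈ hodge B`. [folklore] -/
theorem tr_mem_hodgeSpan_iff (hθ : ∀ P Q : G, θ (P * Q) = θ P + θ Q) (hθc : θ c = (2, 0)) (hc2 : c * c = 1) (v : Ty B → ℤ) :
    tr θ hθ hθc v ∈ hodgeSpan c hc2 ↔ v ∈ hodge B := by
  rw [← map_hodge θ hθ hθc hc2, Submodule.mem_map_equiv, LinearEquiv.symm_apply_apply]

/-- Inverse membership form: `tr⁻¹ y ∈ hodge B ↔ y ∈ hodgeSpan`. [folklore] -/
theorem symm_mem_hodge_iff (hθ : ∀ P Q : G, θ (P * Q) = θ P + θ Q) (hθc : θ c = (2, 0)) (hc2 : c * c = 1) (y : CMF G c →₀ ℤ) :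
    (tr θ hθ hθc).symm y ∈ hodge B ↔ y ∈ hodgeSpan c hc2 := by
  rw [← tr_mem_hodgeSpan_iff θ hθ hθc hc2, LinearEquiv.apply_symm_apply]

/-! ## §6 The two transfers -/

/-- **MODEL ⟹ INTRINSIC.**  If the translates of a family `S` of clock faces (at distinct places) generate the model's Hodge lattice modulo the
pairs, then the transported family — at most `|S|` abstract faces — generates `hodgeSpan` modulo `ℤ⟨pairSet⟩` with its base changes. [folklore] -/
theorem generate_of_model (hθ : ∀ P Q : G, θ (P * Q) = θ P + θ Q) (hθc : θ c = (2, 0)) (hc2 : c * c = 1)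
    {S : Finset (Ty B × (ZMod 2 × B) × (ZMod 2 × B))} (hS : hodge B ≤ pairs B ⊔ spanFaces B S) :
    hodgeSpan c hc2 ≤ Submodule.span ℤ (pairSet c) ⊔ Submodule.span ℤ (translates c (faces θ hθ hθc S)) := by
  rw [← map_hodge θ hθ hθc hc2, ← map_pairs θ hθ hθc, ← map_spanFaces θ hθ hθc, ← Submodule.map_sup]
  exact Submodule.map_mono hS

/-- **MODEL ⟹ INTRINSIC, packaged**: a model family of faces at distinct places generating modulo pairs yields `S' ⊆ gfaceSet` with `|S'| ≤ |S|`
generating `hodgeSpan` modulo pairs. [folklore] -/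
theorem exists_gfaces_of_model (hθ : ∀ P Q : G, θ (P * Q) = θ P + θ Q) (hθc : θ c = (2, 0)) (hc2 : c * c = 1)
    {S : Finset (Ty B × (ZMod 2 × B) × (ZMod 2 × B))} (hS1 : ∀ f ∈ S, f.2.1 ≠ f.2.2) (hS : hodge B ≤ pairs B ⊔ spanFaces B S) :
    ∃ S' : Finset (CMF G c →₀ ℤ), ↑S' ⊆ gfaceSet G c hc2 ∧ S'.card ≤ S.card ∧
      hodgeSpan c hc2 ≤ Submodule.span ℤ (pairSet c) ⊔ Submodule.span ℤ (translates c S') :=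
  ⟨faces θ hθ hθc S, faces_subset_gfaceSet θ hθ hθc hc2 hS1, card_faces_le θ hθ hθc S, generate_of_model θ hθ hθc hc2 hS⟩

/-- **INTRINSIC ⟹ MODEL.**  If the base changes of a family `S₀` of abstract vectors generate `hodgeSpan` modulo `ℤ⟨pairSet⟩`, then the translates
of the inverse-transported family generate the model's Hodge lattice modulo the pairs. [folklore] -/
theorem model_generate_of_translates (hθ : ∀ P Q : G, θ (P * Q) = θ P + θ Q) (hθc : θ c = (2, 0)) (hc2 : c * c = 1)
    (S₀ : Finset (CMF G c →₀ ℤ)) (hS : hodgeSpan c hc2 ≤ Submodule.span ℤ (pairSet c) ⊔ Submodule.span ℤ (translates c S₀)) :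
    hodge B ≤ pairs B ⊔ Submodule.span ℤ
      {w : Ty B → ℤ | ∃ g : ZMod 4 × B, ∃ v ∈ S₀.image (tr θ hθ hθc).symm, w = transl B g v} := by
  rw [← Submodule.map_le_map_iff_of_injective (f := (tr θ hθ hθc : (Ty B → ℤ) →ₗ[ℤ] (CMF G c →₀ ℤ))) (tr θ hθ hθc).injective,
    map_hodge θ hθ hθc hc2, Submodule.map_sup, map_pairs θ hθ hθc, Submodule.map_span]
  refine hS.trans (sup_le_sup_left (Submodule.span_mono ?_) _)
  rintro _ ⟨Q, s, hs, rfl⟩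
  refine ⟨transl B (-(θ Q).1, (θ Q).2) ((tr θ hθ hθc).symm s), ⟨(-(θ Q).1, (θ Q).2), (tr θ hθ hθc).symm s,
    Finset.mem_image.mpr ⟨s, hs, rfl⟩, rfl⟩, ?_⟩
  rw [LinearEquiv.coe_coe, ← mapDomain_rt_tr θ hθ hθc, LinearEquiv.apply_symm_apply]

/-- The inverse-transported family is no larger. [folklore] -/
theorem card_image_symm_le (hθ : ∀ P Q : G, θ (P * Q) = θ P + θ Q) (hθc : θ c = (2, 0)) (S₀ : Finset (CMF G c →₀ ℤ)) :
    (S₀.image (tr θ hθ hθc).symm).card ≤ S₀.card :=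
  Finset.card_image_le

/-- Hodge vectors go to model Hodge vectors under the inverse transport. [folklore] -/
theorem mem_hodge_of_mem_image (hθ : ∀ P Q : G, θ (P * Q) = θ P + θ Q) (hθc : θ c = (2, 0)) (hc2 : c * c = 1)
    {S₀ : Finset (CMF G c →₀ ℤ)} (hS₀ : (S₀ : Set (CMF G c →₀ ℤ)) ⊆ hodgeSpan c hc2) :
    ∀ v ∈ S₀.image (tr θ hθ hθc).symm, v ∈ hodge B := by
  intro v hv
  obtain ⟨y, hy, rfl⟩ := Finset.mem_image.mp hv
  exact (symm_mem_hodge_iff θ hθ hθc hc2 y).mpr (hS₀ (Finset.mem_coe.mpr hy))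

/-- **INTRINSIC ⟹ MODEL for face families**: a family `S₀ ⊆ gfaceSet` generating `hodgeSpan` modulo pairs yields a model family of HODGE vectors,
of at most the same size, whose translates generate `hodge B` modulo `pairs B` — the hypotheses of seat b09's floors. [folklore] -/
theorem exists_model_family_of_gfaces (hθ : ∀ P Q : G, θ (P * Q) = θ P + θ Q) (hθc : θ c = (2, 0)) (hc2 : c * c = 1)
    {S₀ : Finset (CMF G c →₀ ℤ)} (hS₀ : (S₀ : Set (CMF G c →₀ ℤ)) ⊆ hodgeSpan c hc2)
    (hS : hodgeSpan c hc2 ≤ Submodule.span ℤ (pairSet c) ⊔ Submodule.span ℤ (translates c S₀)) :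
    ∃ S : Finset (Ty B → ℤ), S.card ≤ S₀.card ∧ (∀ v ∈ S, v ∈ hodge B) ∧
      hodge B ≤ pairs B ⊔ Submodule.span ℤ {w : Ty B → ℤ | ∃ g : ZMod 4 × B, ∃ v ∈ S, w = transl B g v} :=
  ⟨S₀.image (tr θ hθ hθc).symm, card_image_symm_le θ hθ hθc S₀, mem_hodge_of_mem_image θ hθ hθc hc2 hS₀,
    model_generate_of_translates θ hθ hθc hc2 S₀ hS⟩

end

end Summit.HodgeConjecture.CorCM.Census.ClockTypes
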